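import Summits.QuantumFields.BalabanUV.Beta.EriceFlowEnclosureB12AsPrintedHistoryContagionShiftFlowZeroTangentGellMannLow
import Summits.QuantumFields.BalabanUV.Beta.EriceFlowEnclosureB12AsPrintedHistoryContagionShiftFlowZeroSemigroupGellMannLowEnd

/-!
# Beta / EriceFlowEnclosureB12AsPrintedHistoryContagionShiftFlowZeroTangentEnd — ASYMPTOTIC FREEDOM IS CONTAGIOUS, part 74: THEOREM 2 AS TYPED + A C¹ LIMIT FUNCTIONAL ⟹ THE
# Λ-COORDINATE OF THE CONTINUUM TRAJECTORIES IS C¹ AND THE GELL-MANN–LOW EQUATION HOLDS AT EVERY SCALE — the carrier END of parts 66–73.  Part 58 (#73e) read gen 41's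
# almost-everywhere theory on the carrier built from `B12BetaAsPrinted.Theorem2Statement` (a HYPOTHESIS — [I] Thm 2 p. 259 is STATED WITHOUT PROOF), `hrg`, NE4 `ScaleShiftRate`,
# node U2's moduli `HistLipschitz` ∕ `FadingMemory`.  HERE the same carrier plus ONE MORE HYPOTHESIS, stated def-free on the LIMIT functional `betaInf S.β` (NOT on Bałaban's β_k,
# and NOT derived from them): part 68's C¹ shape — a gradient `G` with the memory profile `|G u j| ≤ Cθ^j` on ]0, γ_u]^ℕ, the uniform first-order remainder letter, and the
# continuity letter of the gradient.  THEN (**`smooth_rg_of_typedTheorem2`**): β₀ > 0 (THE value at the zero history), `b ∈ ]0, β₀]` and, for every torus exponent m, a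
# threshold g₂₅ > 0 such that for EVERY reference coupling `g′ ≤ g₂₅` carrying a Theorem-2-type family there is the Λ-function `Λf` of the continuum trajectories
# (`Λf g′ = 0`, strictly antitone) with, writing `φ_s g := invFunOn Λf (Ioc 0 g′) (Λf g + sβ₀)`: (orbits) **`φ_k g = gstar rows k`** for every Theorem-2-type family pinned
# at `g ∈ ]0, g′]`; (C¹) **`ContDiffOn ℝ 1 Λf (Ioo 0 g′)`** with **`Λf′(x) < 0` and `|(−x³∕2)Λf′(x) − 1| ≤ C(8x³ + 16x∕b)∕(1−θ)` at EVERY x ∈ ]0, g′[**; (Gell-Mann–Low EVERYWHERE)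
# **`∂_s φ_s g = β₀∕Λf′(φ_s g)` at EVERY real scale with `Λf g + sβ₀ > 0`**; (C¹ orbits) `s ↦ φ_s g ∈ C¹(]0, ∞[)` for every pin; (β-function) `β₀∕Λf′` continuous and negative
# on ]0, g′[ with the one-loop envelope at every coupling.  Compare part 58: there «almost every scale», here «every scale» — the price is the C¹ letter on the limit functional
# (β-flow team, prover 1 = recursion ∕ upper ∕ bare-coupling ∕ uniqueness side, unit `b2b-balaban-beta-bflow-p1`, gen 42; ROW AP-I·Uc × NODE U2 — carrier END of the tangent
# flow, over parts 70–72, part 36's `package_threshold_exists`, part 35's `relativeLambda_exists`, part 16's `reference_of_typedTheorem2`, part 32's `exists_valueAtZero` ∕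
# `rate_le_valueAtZero`, part 46's `rg_natCast_eq`)

HONEST FRAMING (page 1 of everything the β sub-cell writes): discharging `BetaPertH` makes Bałaban's UV stability UNCONDITIONAL — a
real constructive-QFT result; it is NOT the continuum limit and NOT the Clay problem.  HONEST DEPENDENCY (cell reorg 2026-08-19,
verbatim): «continuum YM on T⁴ ⇐ BetaPertH ∧ nine spine estimates (0/9 proved); BetaPertH ⇐ (D1) ∧ (D4) ∧ CAP+tail; G-an2-4 gates
asym, D1 and NE2/3/4.»  THIS MODULE DISCHARGES NOTHING: it reads parts 70–72 on the carrier built by parts 16 ∕ 32 ∕ 35 ∕ 36 ∕ 46 from `B12BetaAsPrinted.Theorem2Statement`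
(a HYPOTHESIS), `hrg`, NE4 `ScaleShiftRate` (GAPS G-t4-U2-1), node U2's `HistLipschitz` ∕ `FadingMemory` (G-t4-U2-2), all BY NAME — nothing restated — PLUS the C¹ letters
`hG` ∕ `hGB` ∕ `hGc` on `betaInf S.β`, EXPLICIT BINDERS (a CONDITIONAL reading: whether Bałaban's β_k, analytic in the couplings by construction ([I] §1), pass a gradient
with the memory profile to their scale-shift limit is NOT PRINTED and NOT asserted; part 73 shows the letters are neither vacuous nor automatic).  NOTHING is asserted
about Bałaban's actual β beyond these hypotheses; «Gell-Mann–Low», «β-function», «continuous renormalization group» are OUR READING; `BetaPertH`; the continuum limit of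
gauge fields; Clay.  [I] = T. Bałaban, Commun. Math. Phys. **109** (1987) 249–301 [Balaban1987RG1].

WHAT THIS FILE PROVES (0 sorry, 0 def): §127 **`smooth_rg_of_typedTheorem2`**.
-/

namespace Summit.QuantumFields.BalabanUV.Beta.EriceFlowEnclosureB12AsPrintedHistoryContagionShiftFlowZeroTangentEnd

open Finset Filter Topology Set Function MeasureTheory
open Literature.MathematicalPhysics.QuantumFieldTheory.Balaban1983to89
open Literature.MathematicalPhysics.QuantumFieldTheory.Balaban1983to89.B12BetaAsPrinted
open Literature.MathematicalPhysics.QuantumFieldTheory.Balaban1983to89.FlowStep (RGEqH HBeta)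
open Literature.MathematicalPhysics.QuantumFieldTheory.Balaban1983to89.T4CouplingMatching (HistLipschitz FadingMemory ScaleShiftRate sprof)
open Literature.MathematicalPhysics.QuantumFieldTheory.Balaban1983to89.T4ContinuumCoupling (gstar)
open Literature.MathematicalPhysics.QuantumFieldTheory.Balaban1983to89.T4BetaStationary (SeqBox MemoryProfile betaInf memoryProfile_betaInf)
open Literature.MathematicalPhysics.QuantumFieldTheory.Balaban1983to89.T4BetaFlowWellPosed (MemFlow solution)
open Summit.QuantumFields.BalabanUV.Beta.EriceFlowEnclosureB12AsPrintedHistoryContagionShiftFlowPicardEnd (reference_of_typedTheorem2)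
open Summit.QuantumFields.BalabanUV.Beta.EriceFlowEnclosureB12AsPrintedHistoryContagionShiftFlowZero (exists_valueAtZero rate_le_valueAtZero)
open Summit.QuantumFields.BalabanUV.Beta.EriceFlowEnclosureB12AsPrintedHistoryContagionShiftFlowZeroOffset (package_of_le succ_le_of_reference_flow)
open Summit.QuantumFields.BalabanUV.Beta.EriceFlowEnclosureB12AsPrintedHistoryContagionShiftFlowZeroLambda (relativeLambda_exists)
open Summit.QuantumFields.BalabanUV.Beta.EriceFlowEnclosureB12AsPrintedHistoryContagionShiftFlowZeroEnd (package_threshold_exists)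
open Summit.QuantumFields.BalabanUV.Beta.EriceFlowEnclosureB12AsPrintedHistoryContagionShiftFlowZeroSemigroup (rg_natCast_eq)
open Summit.QuantumFields.BalabanUV.Beta.EriceFlowEnclosureB12AsPrintedHistoryContagionShiftFlowZeroTangentLambda (differentiableAt_dynAbel)
open Summit.QuantumFields.BalabanUV.Beta.EriceFlowEnclosureB12AsPrintedHistoryContagionShiftFlowZeroTangentSmooth (contDiffOn_dynAbel)
open Summit.QuantumFields.BalabanUV.Beta.EriceFlowEnclosureB12AsPrintedHistoryContagionShiftFlowZeroTangentGellMannLow (rg_hasDerivAt_flow rg_contDiffOn_flow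
  betaFunction_continuous_oneLoop)

noncomputable section

variable {S : Setting}

/-! ## §127 Theorem 2 AS TYPED + a C¹ limit functional: the continuum running coupling obeys the Gell-Mann–Low equation at every scale -/

/-- **THEOREM 2 AS TYPED + A C¹ LIMIT FUNCTIONAL ⟹ A C¹ Λ-COORDINATE AND THE GELL-MANN–LOW EQUATION AT EVERY SCALE.**  `Theorem2Statement S hL` (a HYPOTHESIS), `hrg` on ]0, γ_u],
NE4 `ScaleShiftRate c θ γ_u S.β` (c ≥ 0), `HistLipschitz Λ γ_u S.β` with `FadingMemory C θ Λ` (0 < θ < 1, C ≥ 0), and the C¹ letters of part 68 ∕ 71 for the LIMIT functional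
`betaInf S.β` with a gradient G (`hG`, `hGB`, `hGc`, constants C, θ on ]0, γ_u]^ℕ).  THEN there are β₀ > 0, `b ∈ ]0, β₀]` and, for every m, g₂₅ > 0 such that for every reference
coupling `g′ ≤ g₂₅` with a Theorem-2-type family `rows′` there is `Λf`, `Λf g′ = 0`, strictly antitone on ]0, g′], with `φ_s g := invFunOn Λf (Ioc 0 g′) (Λf g + sβ₀)`:
(orbits) `φ_k g = gstar rows k`; (C¹) `ContDiffOn ℝ 1 Λf (Ioo 0 g′)`, `Λf′ < 0` and `|(−x³∕2)Λf′(x) − 1| ≤ C(8x³ + 16x∕b)∕(1−θ)` on ]0, g′[; (Gell-Mann–Low) `∂_s φ_s g = β₀∕Λf′(φ_s g)`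
at EVERY s with `0 < Λf g + sβ₀`; (C¹ orbits) `s ↦ φ_s g ∈ C¹(]0, ∞[)` for `g ∈ ]0, g′]`; (β-function) `β₀∕Λf′` continuous and negative on ]0, g′[.
[cite: Balaban1987RG1, Thm 2 (0.31) p.259 with (0.20) p.256 and §5 p.298] -/
theorem smooth_rg_of_typedTheorem2 {hL : Odd S.L ∧ 1 < S.L} (h : Theorem2Statement S hL)
    {γu θ C c : ℝ} {Λ : ℕ → ℕ → ℝ} {G : (ℕ → ℝ) → ℕ → ℝ} (hγu : 0 < γu)
    (hrg : ∀ P : B12.RunParams, Step.InInterval γu P.K (S.cpl P) → RGEqH P.K S.β (S.cpl P))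
    (hS : ScaleShiftRate c θ γu S.β) (hL' : HistLipschitz Λ γu S.β) (hΛ : FadingMemory C θ Λ)
    (hθ0 : 0 < θ) (hθ1 : θ < 1) (hC : 0 ≤ C) (hc : 0 ≤ c)
    (hG : ∀ u : ℕ → ℝ, SeqBox γu u → ∀ j, |G u j| ≤ C * θ ^ j)
    (hGB : ∀ ε > 0, ∃ ρ > 0, ∀ u u' : ℕ → ℝ, SeqBox γu u → SeqBox γu u' → (∀ j, |u' j - u j| ≤ ρ) →
      |betaInf S.β u' - betaInf S.β u - ∑' j, G u j * (u' j - u j)| ≤ ε * ∑' j, θ ^ j * |u' j - u j|)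
    (hGc : ∀ ε > 0, ∃ ρ > 0, ∀ u u' : ℕ → ℝ, SeqBox γu u → SeqBox γu u' → (∀ j, |u' j - u j| ≤ ρ) → ∀ j, |G u' j - G u j| ≤ ε * θ ^ j)
    (m : ℕ) :
    ∃ β₀ b g₂₅ : ℝ, 0 < b ∧ b ≤ β₀ ∧ 0 < g₂₅ ∧ (∀ u : ℕ → ℝ, SeqBox γu u → |betaInf S.β u - β₀| ≤ C * ∑' j, θ ^ j * u j) ∧
      ∀ (g' : ℝ) (rows' : ℕ → ℕ → ℝ), 0 < g' → g' ≤ g₂₅ →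
      (∀ K, ∃ (m' : ℕ) (g₀ : ℝ), rows' K = S.cpl ⟨K, m', g₀⟩) → (∀ K, Step.InInterval γu K (rows' K)) → (∀ K, rows' K K = g') →
      ∃ Λf : ℝ → ℝ, Λf g' = 0 ∧ StrictAntiOn Λf (Ioc 0 g') ∧
        (∀ (g : ℝ) (rows : ℕ → ℕ → ℝ), 0 < g → g ≤ g' →
          (∀ K, ∃ (m' : ℕ) (g₀ : ℝ), rows K = S.cpl ⟨K, m', g₀⟩) → (∀ K, Step.InInterval γu K (rows K)) → (∀ K, rows K K = g) →
          ∀ k : ℕ, invFunOn Λf (Ioc 0 g') (Λf g + (k : ℝ) * β₀) = gstar rows k) ∧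
        ContDiffOn ℝ 1 Λf (Ioo 0 g') ∧
        (∀ x ∈ Ioo (0 : ℝ) g', deriv Λf x < 0 ∧ |(-(x ^ 3) / 2) * deriv Λf x - 1| ≤ C * (8 * x ^ 3 + 16 * x / b) / (1 - θ)) ∧
        (∀ g s : ℝ, 0 < Λf g + s * β₀ →
          HasDerivAt (fun σ : ℝ => invFunOn Λf (Ioc 0 g') (Λf g + σ * β₀)) (β₀ / deriv Λf (invFunOn Λf (Ioc 0 g') (Λf g + s * β₀))) s) ∧
        (∀ g ∈ Ioc (0 : ℝ) g', ContDiffOn ℝ 1 (fun s : ℝ => invFunOn Λf (Ioc 0 g') (Λf g + s * β₀)) (Ioi 0)) ∧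
        ContinuousOn (fun x : ℝ => β₀ / deriv Λf x) (Ioo 0 g') ∧ (∀ x ∈ Ioo (0 : ℝ) g', β₀ / deriv Λf x < 0) := by
  have h1θ : 0 < 1 - θ := by linarith
  have hB := memoryProfile_betaInf hS hL' hΛ hθ0.le hθ1
  obtain ⟨β₀, h0⟩ := exists_valueAtZero hB hC hθ0.le hθ1 hγu
  obtain ⟨gr, b, g₂, -, t, hgr, hb, hg₂, -, htbox, htflow, hprof, hmem, -⟩ :=
    reference_of_typedTheorem2 h hγu hrg hS hL' hΛ hθ0 hθ1 hC hc m
  have h2gr : 0 < 2 * gr := by positivity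
  have hbβ : b ≤ β₀ := rate_le_valueAtZero hC hθ0.le hθ1 hb h2gr h0 htbox htflow hprof
  have hβ₀ : 0 < β₀ := hb.trans_le hbβ
  obtain ⟨e₀, he₀, hthr⟩ := package_threshold_exists (1 / gr ^ 2 + C * γu / (1 - θ) ^ 2 + (2 * C / ((1 - θ) * b)) ^ 2) hC hθ1 hb
  refine ⟨β₀, b, min e₀ (min g₂ (γu / 2)), hb, hbβ, lt_min he₀ (lt_min hg₂ (by positivity)), h0, fun g' rows' hg' hle hrow' hI' hpin' => ?_⟩
  obtain ⟨hs1, hs2, hs4, hs5⟩ := hthr g' hg' (hle.trans (min_le_left _ _))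
  have hle2' : g' ≤ g₂ := hle.trans ((min_le_right _ _).trans (min_le_left _ _))
  have h2g' : 2 * g' ≤ γu := by linarith [hle.trans ((min_le_right _ _).trans (min_le_right _ _))]
  have hγ : 0 ≤ γu := hγu.le
  obtain ⟨hbox', hflow'⟩ := hmem rows' g' hrow' hI' hpin' hle2'
  obtain ⟨Λf, hΛ0, hΛh, -, hanti, -, habel, huniq⟩ :=
    relativeLambda_exists hB hC hθ0.le hθ1 hb h2gr h0 htbox htflow hprof hg' h2g' hs1 hs2 hs4 hs5 hbox' hflow'
  have hdyn : ∀ e ∈ Ioc (0 : ℝ) g', ∀ hh : ℕ → ℝ, SeqBox γu hh → MemFlow (betaInf S.β) e hh →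
      Tendsto (fun n => 1 / hh n ^ 2 - 1 / (gstar rows' n) ^ 2) atTop (𝓝 (Λf e)) := hΛh
  have honto : ∀ y : ℝ, Λf g' ≤ y → ∃ x ∈ Ioc (0 : ℝ) g', Λf x = y := by
    intro y hy
    rw [hΛ0] at hy
    obtain ⟨x, ⟨hx, hxy⟩, -⟩ := huniq y hy
    exact ⟨x, hx, hxy⟩
  have hβc := betaFunction_continuous_oneLoop hB hC hθ0.le hθ1 hb h2gr htbox htflow hprof hG hGB hGc hdyn hβ₀ h2g' hs1 hs2 hs4 hs5
  refine ⟨Λf, hΛ0, hanti, fun g rows hg hgg' hrow hI hpin k => ?_,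
    contDiffOn_dynAbel hB hC hθ0.le hθ1 hb h2gr htbox htflow hprof hG hGB hGc hdyn h2g' hs1 hs2 hs4 hs5,
    fun x hx => ?_, fun g s hgs => ?_,
    fun g hg => rg_contDiffOn_flow hB hC hθ0.le hθ1 hb h2gr htbox htflow hprof hG hGB hGc hdyn hanti honto hβ₀ h2g' hs1 hs2 hs4 hs5 hg,
    hβc.1, fun x hx => (hβc.2 x hx).1⟩
  · -- the integer times are the continuum running coupling
    obtain ⟨hbox, hflow⟩ := hmem rows g hrow hI hpin (hgg'.trans hle2')
    have hgmem : g ∈ Ioc (0 : ℝ) g' := ⟨hg, hgg'⟩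
    obtain ⟨p1, p2, -, -⟩ := package_of_le hC hθ1 hb hγ hg hgg' hs1 hs2 hs4 hs5
    have hkmem : ∀ k, gstar rows k ∈ Ioc (0 : ℝ) g' := fun k =>
      ⟨(hbox k).1, (succ_le_of_reference_flow hB hC hθ0.le hθ1 hb h2gr h0 htbox htflow hprof hbox hflow p1 p2 k).2.2.trans hgg'⟩
    exact rg_natCast_eq hanti honto hβ₀.le hgmem hkmem (habel g hgmem _ hbox hflow) k
  · obtain ⟨-, hneg, hone, -⟩ := differentiableAt_dynAbel hB hC hθ0.le hθ1 hb h2gr htbox htflow hprof hG hGB hdyn h2g' hs1 hs2 hs4 hs5 hx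
    exact ⟨hneg, hone⟩
  · have hgs' : Λf g' < Λf g + s * β₀ := by rw [hΛ0]; exact hgs
    exact rg_hasDerivAt_flow hB hC hθ0.le hθ1 hb h2gr htbox htflow hprof hG hGB hdyn hanti honto hβ₀ h2g' hs1 hs2 hs4 hs5 hgs'

end

end Summit.QuantumFields.BalabanUV.Beta.EriceFlowEnclosureB12AsPrintedHistoryContagionShiftFlowZeroTangentEnd
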